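import Summits.QuantumFields.BalabanUV.T4Continuum.Spine.NE1p.DressedTwoSidedRegularityWitness

/-!
# T⁴ programme, spine estimate NE1′ (node O3b/H2) — THE (I4′) SOCKET OF THE SAME-LATTICE FACE FIRES ON `ℤ²`, PART 2: THE END —
# N0f §3 `hlin_of_twoSidedRegularity` + `hdefw_of_window` INHABITED by Part 1's lattice datum, ROOT-C OF RECORD reached THROUGH them

Cell `pub-balaban`, sub-cell `t4`, BINDER-OWNERS row NE1′, NE1′ formalisation crew `b2b-balaban-t4-ne1p-formalise-*`, seat `…-leaf-06`
(gen 5).  ADDITIVE — imports Part 1 `Spine/NE1p/DressedTwoSidedRegularityWitness` ONLY (which imports the owner's N0f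
`DressedRootSameLattice` p218843); THEOREMS ONLY (0 `def`); modifies nothing.  THE BINDERS EXERCISED (file and line of N0f): §3
`hlin_of_twoSidedRegularity` l.253 — `hcδ`∕`hr`∕`hψ`∕`ha` l.256, the per-generation NORMALISATION `hnorm` l.257, the attaining-pair binder
`hpair` l.258–262 (base in the regular set, BOTH partners `UnitaryLike`, BOTH `PlaqSup … (aᵢ·ψ^(k−k′))`, attainment) — and `hdefw_of_window`
l.282 (`hw` l.283); no landed file applies them (N0h p219111 is on the complex line with `rel = Eq`; S3v p219142 carries `hnorm`∕`hpair`
as displayed binders; W18–W21 are complex-line charts).  Typer R-T80 (vi).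
* §4 `hpair` DISCHARGED, TWO-SIDED AND CURVED (`twPair`): for the birth generation at scale `k` the pair is `U₀ = bump e^{−iφ_k}`,
  `U₁ = bump e^{+iφ_k}` (Part 1) — BOTH unitary-like, `val U₀ ∈ 𝒦tw`, BOTH CURVED with `‖plaq − 1‖ ≤ ‖e^{±iφ_k} − 1‖ ≤ φ_k = aᵢ·ψ^k`,
  `a₁ = a₀ = 1/16`, `ψ = (2²)⁻¹`; the response `(1/8)^K·‖e^{iφ_k} − e^{−iφ_k}‖ = (1/8)^K·2 sin φ_k` IS the booked size
  (`response_eq_twSize`: ATTAINED WITHOUT SLACK); the base is NOT flat (`base_curved`: the `a₀` side is not idle).  THE NORMALISATION IS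
  MET WITH EQUALITY: `(d−1)(Lg−1)(a₁+a₀) = (2−1)(2−1)(1/16+1/16) = 2·(1/16) = c_δ·r` (`hnorm_tw`), and `hdefw_of_window`'s `hw` is TIGHT:
  `c_δ·r = 1/8 = w`.
* §5 THE END **`twoSidedSocket_fires : DressedStabilityStrict twTower ((2:ℝ)^4)`** = N0f `dressedStabilityStrict_of_sameLattice` BY NAME, ONE
  application, at `L = 2, c_δ = 2 (transport constant 4c_δ = 8), c̄ = 0, N₀ = 1, A₀ = 24 (births: 8·3·(1/8)^K = twoRate 24 ρ₁ 2⁻³ K 0 0,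
  EQUALITY), m = 1/48 (48m = 1 TIGHT), s̄⁰ = 0, ρ′ = locOf 2 1 8 0 = 1/2`, with `𝒰 := Fld 2 ℂ`, `move := latMove`, `Nw := latN`,
  `rel := BlockRel 2 0`, `𝒦 := 𝒦tw`, its `hlin` := `hlin_of_twoSidedRegularity …` fed by `twPair` and its `hdefw` := `hdefw_of_window …`
  BY NAME, `hrate` := `le_rfl`; the headline `dressedStability_twTower` and ROOT-B `dressedBudget_twTower` (positional count
  `positionalCount_tw` at the SAME rate `2⁴ = Λ`, k4) through N0f §2 BY NAME; `twoSidedSocket_nonvacuous` bundles ROOT-C + positive sizes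
  + curved bases.

HONEST FRAMING (c3∕c4∕c6; t4-ref2 (m3)∕(m7)).  A decided `U(1)` lattice toy on ONE plaquette; it inhabits the SHAPES of the (I4′) socket and
says NOTHING about Bałaban's minimisers or backgrounds, the cell's D-terms, or `SU(2)`; (I4′) for the cell's pairs remains a HYPOTHESIS of
printed TYPE ([Balaban1985Variational] Thm 1 (8) — context, not used); `ψ = L⁻²` is the cell's rate read through `hrate`, not print.
0 `def`; 0 sorry; 0 citations.  Headline (c4): «the (I4′) socket fires on one decided lattice datum», never «NE1′ proved»; wall v1.4 of
record, v1.5 met (Q42 (b1)+(b2)), T4-DAG rewording owed.  NE1′ NOT printed, NOT proved; spine PROVED 0∕9.  Rung (B)+1 on ONE finite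
four-torus — NOT infinite volume, NOT a mass gap, NOT OS on ℝ⁴, NOT Clay.
HONEST DEPENDENCY: continuum YM on T⁴ ⇐ BetaPertH ∧ nine spine estimates (0/9 proved); BetaPertH ⇐ (D1) ∧ (D4) ∧ CAP+tail; G-an2-4 gates
asym, D1 and NE2/3/4.
-/

noncomputable section

namespace Summit.QuantumFields.BalabanUV.T4Continuum.NE1p.DressedTwoSidedRegularityWitness

open Finset Metric Set Complex
open scoped BigOperators
open Literature.MathematicalPhysics.QuantumFieldTheory.Balaban1983to89
open Literature.MathematicalPhysics.QuantumFieldTheory.Balaban1983to89.T4TermFormat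
open Literature.MathematicalPhysics.QuantumFieldTheory.Balaban1983to89.T4TrajectoryComparison
open Literature.MathematicalPhysics.QuantumFieldTheory.Balaban1983to89.T4BirthChartTransport (GaugeInvariant BirthSlice)
open Literature.MathematicalPhysics.QuantumFieldTheory.Balaban1983to89.B8Lemma1Lattice (e InBlock)
open Literature.MathematicalPhysics.QuantumFieldTheory.Balaban1983to89.T4RelativeLadder (UnitaryLike)
open Literature.MathematicalPhysics.QuantumFieldTheory.Balaban1983to89.T4RelativeComb (Cfg plaq PlaqSup)
open Literature.MathematicalPhysics.QuantumFieldTheory.Balaban1983to89.T4BlockTransport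
  (Fld val val_apply NDir latMove latN norm_dir_le BlockRel)
open Summit.QuantumFields.BalabanUV.T4Continuum.T4TrajectoryDensityDressed
open Summit.QuantumFields.BalabanUV.T4Continuum.NE1p.DressedRoot
open Summit.QuantumFields.BalabanUV.T4Continuum.NE1p.DressedUniformConstants
open Summit.QuantumFields.BalabanUV.T4Continuum.NE1p.DressedRootSameLattice

/-! ## §4 The (I4′) socket's binders discharged: normalisation with equality, two-sided CURVED attaining pairs -/

/-- **THE NORMALISATION `hnorm` IS MET WITH EQUALITY** [arith]: `(d−1)(Lg−1)(a₁+a₀) = (2−1)(2−1)(1/16+1/16) = 2·(1/16) = c_δ·r`, and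
`c_δ·r = 1/8 = w` (the window binder `hw` of `hdefw_of_window` is tight too). -/
theorem hnorm_tw : (((2 : ℕ) : ℝ) - 1) * (((2 : ℕ) : ℝ) - 1) * ((1 / 16 : ℝ) + 1 / 16) = 2 * (1 / 16) ∧
    (2 : ℝ) * (1 / 16) = 1 / 8 := by
  norm_num

/-- THE BASE OF THE ATTAINING PAIR IS CURVED [decided toy]: `plaq (bump e^{−iφ_k}) (0; e₀, e₁) = e^{−iφ_k} ≠ 1` — the `a₀` side of the
two-sided regularity is NOT idle. -/
theorem base_curved (k : ℕ) : plaq (bump (expUnit (-φ k))) 0 0 1 ≠ 1 := by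
  rw [(plaq_bump_zero _).1]
  intro h
  have h' : ((expUnit (-φ k) : ℂˣ) : ℂ) = 1 := by rw [h, Units.val_one]
  have hn := Complex.norm_exp_I_mul_ofReal_sub_one (-φ k)
  rw [← expUnit_val, h', sub_self, norm_zero, neg_div, Real.sin_neg, mul_neg, norm_neg, Real.norm_eq_abs] at hn
  have hsin : 0 < Real.sin (φ k / 2) :=
    Real.sin_pos_of_pos_of_lt_pi (by have := φ_pos k; positivity) (by have := φ_pos k; have := φ_lt_pi k; linarith)
  have : (0 : ℝ) < |2 * Real.sin (φ k / 2)| := abs_pos.mpr (mul_ne_zero two_ne_zero hsin.ne')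
  linarith

/-- **THE RESPONSE IS THE BOOKED SIZE** [decided toy]: `‖twFn K 0 (val (bump e^{iφ_k})) − twFn K 0 (val (bump e^{−iφ_k}))‖ =
(1/8)^K·‖e^{iφ_k} − e^{−iφ_k}‖ = (1/8)^K·2 sin φ_k = twSize K k` — ATTAINED WITHOUT SLACK. -/
theorem response_eq_twSize (K k : ℕ) :
    ‖twFn K 0 (val (bump (expUnit (φ k)))) - twFn K 0 (val (bump (expUnit (-φ k))))‖ = twSize K k := by
  show ‖(coef K : ℂ) * plaqFn (val (bump (expUnit (φ k)))) - (coef K : ℂ) * plaqFn (val (bump (expUnit (-φ k))))‖ = twSize K k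
  rw [plaqFn_val_bump, plaqFn_val_bump, ← mul_sub, norm_mul, Complex.norm_real, Real.norm_of_nonneg (coef_pos K).le,
    expUnit_val, expUnit_val, norm_exp_sub_exp_neg (φ_pos k).le (φ_lt_pi k).le]
  rfl

/-- **THE (I4′) SOCKET'S ATTAINING-PAIR BINDER `hpair`, DISCHARGED** [decided toy]: for the birth generation at every scale `k ≤ K` (under
ANY history) the pair `U₀ = bump e^{−iφ_k}`, `U₁ = bump e^{+iφ_k}` has its base in the regular set, BOTH partners unitary-like, BOTH
based-plaquette deviations on `B(0)` at most `aᵢ·ψ^(k−0)`, `a₁ = a₀ = 1/16`, `ψ = (2²)⁻¹`, and response EQUAL to the booked size; the absent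
later generations book `0` (flat pair). -/
theorem twPair (K : ℕ) (Gate : ℕ → Prop) :
    ∀ (b : (twBooking K).Birth) (k' k : ℕ), (twBooking K).birthScale b ≤ k' → k' ≤ k → k ≤ (twBooking K).K →
      RanBelow Gate k → ∀ ε > 0,
      ∃ U₀ U₁ : Cfg 2 ℂ, val U₀ ∈ 𝒦tw ∧ (∀ x ν, UnitaryLike (U₀ x ν)) ∧ (∀ x ν, UnitaryLike (U₁ x ν)) ∧
        PlaqSup 2 0 (fun y ρ ν => ‖(plaq U₁ y ρ ν : ℂ) - 1‖) ((1 / 16 : ℝ) * (((2 : ℝ) ^ 2)⁻¹) ^ (k - k')) ∧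
        PlaqSup 2 0 (fun y ρ ν => ‖(plaq U₀ y ρ ν : ℂ) - 1‖) ((1 / 16 : ℝ) * (((2 : ℝ) ^ 2)⁻¹) ^ (k - k')) ∧
        (twTrajectory K).lin b k' k ≤ ‖twFn K k' (val U₁) - twFn K k' (val U₀)‖ + ε := by
  intro b k' k _ _ _ _ ε hε
  cases k' with
  | succ n =>
    have h1 : ∀ x ν, UnitaryLike ((1 : Cfg 2 ℂ) x ν) := fun _ _ => T4RelativeLadder.UnitaryLike.one
    have hflat : PlaqSup 2 0 (fun y ρ ν => ‖(plaq (1 : Cfg 2 ℂ) y ρ ν : ℂ) - 1‖) ((1 / 16 : ℝ) * (((2 : ℝ) ^ 2)⁻¹) ^ (k - (n + 1))) := by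
      intro y ρ ν _ _ _ _ _
      show ‖((plaq (1 : Cfg 2 ℂ) y ρ ν : ℂˣ) : ℂ) - 1‖ ≤ _
      simp only [T4RelativeComb.plaq, Pi.one_apply, mul_one, inv_one, Units.val_one, sub_self, norm_zero]
      positivity
    exact ⟨1, 1, val_mem_𝒦tw h1, h1, h1, hflat, hflat, by show (0 : ℝ) ≤ _; positivity⟩
  | zero =>
    have hφ : |φ k| = (1 / 16 : ℝ) * (((2 : ℝ) ^ 2)⁻¹) ^ (k - 0) := by rw [Nat.sub_zero, abs_of_pos (φ_pos k)]; rfl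
    have hφ' : |-φ k| = (1 / 16 : ℝ) * (((2 : ℝ) ^ 2)⁻¹) ^ (k - 0) := by rw [abs_neg, hφ]
    refine ⟨bump (expUnit (-φ k)), bump (expUnit (φ k)), val_mem_𝒦tw (unitaryLike_bump (unitaryLike_expUnit _)),
      unitaryLike_bump (unitaryLike_expUnit _), unitaryLike_bump (unitaryLike_expUnit _),
      plaqSup_bump (hφ ▸ norm_expUnit_sub_one_le (φ k)), plaqSup_bump (hφ' ▸ norm_expUnit_sub_one_le (-φ k)), ?_⟩
    show twSize K k ≤ _
    rw [response_eq_twSize]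
    linarith

/-! ## §5 THE END: ROOT-C of record THROUGH the (I4′) socket -/

/-- **THE (I4′) SOCKET FIRES** [decided toy]: `DressedStabilityStrict twTower (2^4)` THROUGH N0f `dressedStabilityStrict_of_sameLattice` — ONE
K-∕μ-free number set (`L = 2`, `c_δ = 2`, `c̄ = 0`, `N₀ = 1`, `A₀ = 24`, `m = 1/48`, `s̄⁰ = 0`, `ρ′ = 1/2`) and, at every cutoff, the
function-level binders ON THE LATTICE: `hinv` for `BlockRel 2 0`, the birth slice along `latMove`∕`latN` at every `U(1)`-valued base, and
`hlin` := N0f §3 `hlin_of_twoSidedRegularity` applied to §4's two-sided curved unitary-like pairs under the normalisation `hnorm` (equality),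
`hdefw` := N0f §3 `hdefw_of_window` (tight), `hrate` := `le_rfl`; births (equality), empty regeneration, counts. -/
theorem twoSidedSocket_fires : DressedStabilityStrict twTower ((2 : ℝ) ^ 4) := by
  refine dressedStabilityStrict_of_sameLattice twTower (L := 2) (cδ := 2) (cbar := 0) (N₀ := 1) (A₀ := 24) (m := 1 / 48)
    (sbar := 0) (ρ' := 1 / 2) (𝒰 := Fld 2 ℂ) (Dir := NDir 2 ℂ) (F := ℂ) (move := latMove)
    (by norm_num) (by norm_num) le_rfl zero_le_one (by norm_num) (by norm_num)
    (by unfold locOf; norm_num) (by norm_num) (by norm_num)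
    (fun _ _ _ => 0) (fun _ _ _ _ => 0) (fun _ _ _ b => {b})
    (fun _ _ _ => le_rfl) (fun _ _ _ _ => le_rfl)
    (fun _ K k b f _ => Nat.zero_le k)
    (fun _ K k b j _ => ?_)
    (fun _ _ _ _ => le_rfl)
    (fun _ K => ?_) (fun _ K => ?_)
    (fun _ K _ k' => twFn K k') (fun _ _ _ _ => BlockRel 2 0) (fun _ _ _ _ => 𝒦tw) (fun _ _ _ _ => latN)
    (fun _ _ _ _ => 1 / 8) (fun _ _ _ _ => 1 / 16) (fun _ _ _ k' k => 2 * (1 / 16) * (((2 : ℝ) ^ 2)⁻¹) ^ (k - k'))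
    (fun _ K _ k' => twFn_gaugeInvariant K k')
    (fun _ K b k' _ _ _ => twFn_birthSlice K k')
    T4BlockTransport.latMove_zero (fun _ _ _ _ => by norm_num)
    (fun _ K b k' k => hdefw_of_window (B := twBooking K) (r := fun _ _ => 1 / 16) (w := fun _ _ => 1 / 8) (cδ := 2)
      (ψ := ((2 : ℝ) ^ 2)⁻¹) (by norm_num) (fun _ _ => by norm_num) (by norm_num) (by norm_num) (fun _ _ => by norm_num) b k' k)
    (fun _ _ _ k' k _ _ _ => le_rfl)
    (fun _ K => hlin_of_twoSidedRegularity (T := twTrajectory K) (Fn := fun _ k' => twFn K k') (Lg := fun _ _ => 2)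
      (zg := fun _ _ => 0) (𝒦 := fun _ _ => 𝒦tw) (a₀ := fun _ _ => 1 / 16) (a₁ := fun _ _ => 1 / 16) (r := fun _ _ => 1 / 16)
      (cδ := 2) (ψ := ((2 : ℝ) ^ 2)⁻¹) (by norm_num) (fun _ _ => by norm_num) (by norm_num) (fun _ _ => by norm_num)
      (fun _ _ => le_of_eq hnorm_tw.1) (twPair K _))
  · -- counts: one live family, `N₀·(2⁴)^{k−j} ≥ 1`
    show ((({b} : Finset Unit).filter fun _ => (0 : ℕ) = j).card : ℝ) ≤ 1 * ((2 : ℝ) ^ 4) ^ (k - j)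
    have h1 : ((({b} : Finset Unit).filter fun _ => (0 : ℕ) = j).card : ℝ) ≤ 1 := by
      exact_mod_cast (Finset.card_filter_le _ _).trans (Finset.card_singleton b).le
    exact h1.trans (by simpa using one_le_pow₀ (M₀ := ℝ) (a := (2 : ℝ) ^ 4) (n := k - j) (by norm_num))
  · -- births: `8·(3·(1/8)^K) = 24·((2⁻¹)^3)^K`, EQUALITY
    intro b _ _ _
    show 4 * 2 * (3 * coef K) ≤ twoRate 24 (rhoOneOf ((2 : ℝ) ^ 2)⁻¹ 1 (4 * 2) 0) ((2 : ℝ)⁻¹ ^ 3) K 0 0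
    simp only [twoRate, Nat.sub_zero, pow_zero, mul_one, coef]
    have h8 : ((2 : ℝ)⁻¹ ^ 3) = 1 / 8 := by norm_num
    rw [h8]
    linarith
  · -- regeneration: the later generations are absent
    intro b k _ _ _
    show (0 : ℝ) ≤ 0 * twSize K k
    simp

/-- … hence the HEADLINE `DressedStability twTower` (N0f `dressedStability_of_sameLattice_strict` BY NAME). [decided toy] -/
theorem dressedStability_twTower : DressedStability twTower :=
  dressedStability_of_sameLattice_strict twTower twoSidedSocket_fires

/-- The bookings' positional count at the SAME rate `2⁴ = Λ` (k4): one birth felt per cube. [decided toy] -/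
theorem positionalCount_tw (K : ℕ) : (twBooking K).PositionalCount fun j k => 1 * ((2 : ℝ) ^ 4) ^ (k - j) := by
  intro q j
  have hc : ((twBooking K).feltOfScale q j).card ≤ 1 :=
    (Finset.card_filter_le _ _).trans (by simp [twBooking])
  calc (((twBooking K).feltOfScale q j).card : ℝ) ≤ 1 := by exact_mod_cast hc
    _ ≤ 1 * ((2 : ℝ) ^ 4) ^ ((twBooking K).cubeScale q - j) := by rw [one_mul]; exact one_le_pow₀ (by norm_num)

/-- … and ROOT-B `DressedBudget twTower wt` for bounded nonnegative weights (N0f `dressedBudget_of_sameLattice_strict` BY NAME). [decided toy] -/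
theorem dressedBudget_twTower {wt : Unit → ℕ → ℕ → ℝ} {wbar : ℝ} (hwbar : 0 ≤ wbar)
    (hw0 : ∀ p K, ∀ j ≤ K, 0 ≤ wt p K j) (hwb : ∀ p K, ∀ j ≤ K, wt p K j ≤ wbar) : DressedBudget twTower wt :=
  dressedBudget_of_sameLattice_strict twTower twoSidedSocket_fires zero_le_one hwbar hw0 hwb (fun _ K => positionalCount_tw K)

/-- NON-VACUITY [decided toy]: ROOT-C of record holds on the toy, every booked size is POSITIVE, and the base of every attaining pair is CURVED
— the (I4′) socket is exercised end to end on genuinely two-sided data. -/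
theorem twoSidedSocket_nonvacuous :
    DressedStabilityStrict twTower ((2 : ℝ) ^ 4) ∧ (∀ K k (b : (twBooking K).Birth), 0 < (twBooking K).size b k) ∧
      ∀ k, plaq (bump (expUnit (-φ k))) 0 0 1 ≠ 1 :=
  ⟨twoSidedSocket_fires, fun K k _ => twSize_pos K k, base_curved⟩

end Summit.QuantumFields.BalabanUV.T4Continuum.NE1p.DressedTwoSidedRegularityWitness

end
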